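import HarnessLib
import Summits.ValiantsHypothesis.Statement
import Literature.Computability.AlgebraicComplexity.GKKSDepthFour
import Literature.Computability.AlgebraicComplexity.HomogeneousDepthFour
import Literature.Computability.AlgebraicComplexity.TavenasDepthFourProofs
import Literature.Computability.AlgebraicComplexity.ValiantConjectureProofs
import Literature.Computability.AlgebraicComplexity.StandardFamiliesProofs

/-!
# The bounded door: crux `Depth4HomFour` re-based one model down, in ONE currency

WEAKEST SUFFICIENT CELL on the chasm axis in ONE currency (HasSPSPExpr, bottom fan-in ⌊√n⌋):
BoundedDoor ⟹ VP ≠ VNP (Tavenas 2015 Thm 1 WITH fan-ins) and 11333 ⟹ BoundedDoor (converse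
NOT claimed; strictness UNDECIDED); KNOWN in print (Landsberg 2017 §7.5–7.6); NOT a rung;
0 S-currency (VP ≠ VNP does not imply BoundedDoor); VP ≠ VNP untouched.

SEAM: the floor 2^{ε√n} in this currency (gkks_depth4_holds) holds for det_n as well, and
det_n ∈ VP has door-sized expressions (Tavenas with fan-ins) — the residual Θ_c(log n) factor
in the exponent is PER-SPECIFIC; any proof of BoundedDoor exhibits, at some n, a property of
per_n that det_n provably lacks.

Currency: the Literature's `HasSPSPExpr f s D t` (`f = ∑_{i<s} ∏_{j<D} Qᵢⱼ`, `deg Qᵢⱼ ≤ t`; the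
currency of `gkks_depth4` / `gkks_perPoly`); the cell is an INLINE hypothesis (no new `Prop`):
`BoundedDoor := ∀ c, ∃ n, ¬ HasSPSPExpr (per_n) ((n+2)^(c⌊√n⌋+c)) (c⌊√n⌋+c) ⌊√n⌋`.  Six theorems
(plus two private summation helpers), no definitions: padding; Tavenas' reduction KEEPING the
fan-ins (from `SLP.exists_sum_prod_component_hom`; the tree's
`homDepthFourCircuitSize_le_of_isVPFamily` drops them) and its permanent instance; the cell's
`closes`; expressions ⟹ homogeneous `ΣΠΣΠ` circuits; the certified ONE-WAY arrow
`boundedDoor_of_depth4HomFour` (hypothesis = stmt 11333 verbatim at `K = ℂ`).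
Window of record per `c`: floor `2^{ε_c √n} ≤ s` for expressions of `per_n` with `D ≤ c₀√n`,
`t ≤ √n` (`gkks_perPoly`, `gkks_depth4_holds` — KERNEL, cited by name, not restated; it holds
for `det_n` too) against the door `s = (n+2)^(c⌊√n⌋+c)`: the residual threshold is the
`Θ_c(log n)` factor in the exponent (Landsberg 2017, p. 205), PER-SPECIFIC.  Non-vacuity: the
currency is inhabited at every `n` (`per_n` is the sum of its `n!` monomials, so
`HasSPSPExpr (per_n) (n!) n 1`), and the NEGATION of BoundedDoor holds for the determinant
family (`det ∈ VP` and `hasSPSPExpr_of_isVPFamily`, on paper), so neither side of the cell is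
empty by typing.  Nothing here is a lower bound: crux 11333, route Depth4 and `VP ≠ VNP` are
untouched; no Literature fact enters as a hypothesis (`perFamily_mem_VNP_holds`,
`mem_VP_ofFintype_iff_holds`, `totalDegree_perPoly_holds` are proved theorems used by name).
References: Tavenas2015 (Thm. 1); GuptaKamathKayalSaptharishi2014 (Thm. 1); Landsberg2017
(Thm. 7.5.2.1, §7.6); AgrawalVinay2008; KumarSaraf2017 (§3).
-/

set_option linter.dupNamespace false

namespace Summit.ValiantsHypothesis.ValiantsHypothesis.Theorems.Depth4BoundedDoor

open MvPolynomial Literature.Computability.AlgebraicComplexity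

/-- Monotonicity of the expression predicate: pad with products containing a factor `0` (needs
`D' ≥ 1`) and with factors `1`; raise the bottom degree. [cite: GuptaKamathKayalSaptharishi2014] -/
theorem hasSPSPExpr_mono {K : Type*} [CommSemiring K] {σ : Type*} {f : MvPolynomial σ K}
    {s s' D D' t t' : ℕ} (h : HasSPSPExpr f s D t) (hs : s ≤ s') (hD : D ≤ D') (hD' : 1 ≤ D')
    (ht : t ≤ t') : HasSPSPExpr f s' D' t' := by
  classical
  obtain ⟨Q, hQ, hf⟩ := h
  obtain ⟨a, rfl⟩ := Nat.exists_eq_add_of_le hs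
  obtain ⟨b, rfl⟩ := Nat.exists_eq_add_of_le hD
  refine ⟨Fin.append (fun i => Fin.append (Q i) (fun _ : Fin b => (1 : MvPolynomial σ K)))
      (fun (_ : Fin a) (j : Fin (D + b)) => if (j : ℕ) = 0 then (0 : MvPolynomial σ K) else 1),
    ?_, ?_⟩
  · intro i j
    refine Fin.addCases (fun i => ?_) (fun i => ?_) i
    · simp only [Fin.append_left]
      refine Fin.addCases (fun j => ?_) (fun j => ?_) j
      · simpa only [Fin.append_left] using (hQ i j).trans ht
      · simp only [Fin.append_right, totalDegree_one, Nat.zero_le]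
    · simp only [Fin.append_right]
      split_ifs
      · simp only [totalDegree_zero, Nat.zero_le]
      · simp only [totalDegree_one, Nat.zero_le]
  · have hrow : ∀ i : Fin s, ∏ j : Fin (D + b),
        Fin.append (Q i) (fun _ : Fin b => (1 : MvPolynomial σ K)) j = ∏ j : Fin D, Q i j := by
      intro i
      rw [Fin.prod_univ_add]
      simp only [Fin.append_left, Fin.append_right, Finset.prod_const_one, mul_one]
    have hpad : ∏ j : Fin (D + b), (if (j : ℕ) = 0 then (0 : MvPolynomial σ K) else 1) = 0 :=
      Finset.prod_eq_zero (Finset.mem_univ (⟨0, by omega⟩ : Fin (D + b))) (if_pos rfl)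
    rw [Fin.sum_univ_add]
    simp only [Fin.append_left, Fin.append_right, hrow, hpad, Finset.sum_const_zero, add_zero]
    exact hf

/-- **Tavenas' depth reduction WITH fan-ins** (any commutative semiring): a `VP` family of
homogeneous polynomials has `ΣΠ^{[a⌊√d⌋+a]}ΣΠ^{[⌊√d⌋]}` expressions with at most `(n+2)^(a⌊√d⌋+a)`
summands (`d = deg fₙ`; `SLP.exists_sum_prod_component_hom`, padded). [cite: Tavenas2015, Thm. 1] -/
theorem hasSPSPExpr_of_isVPFamily {K : Type*} [CommSemiring K] {σ : ℕ → Type*}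
    [∀ n, Fintype (σ n)] (f : ∀ n, MvPolynomial (σ n) K) (hf : IsVPFamily f)
    (hfhom : ∀ n, (f n).IsHomogeneous (f n).totalDegree) :
    ∃ a : ℕ, ∀ n : ℕ,
      HasSPSPExpr (f n) ((n + 2) ^ (a * Nat.sqrt (f n).totalDegree + a))
        (a * Nat.sqrt (f n).totalDegree + a) (Nat.sqrt (f n).totalDegree) := by
  classical
  obtain ⟨⟨⟨a1, h1⟩, ⟨a2, h2⟩⟩, ⟨a3, h3⟩⟩ := hf
  set a := a1 + a2 + a3 with ha
  set E := a + 2 with hE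
  refine ⟨48 * E + 32, fun n => ?_⟩
  set A := 48 * E + 32 with hA
  have hgh := hfhom n
  set B := n + 2 with hB
  set g := f n
  set d := g.totalDegree with hd
  set t := Nat.sqrt d with htd
  have hB2 : 2 ≤ B := by rw [hB]; omega
  have hA1 : 1 ≤ A := by rw [hA]; omega
  have hAt : 1 ≤ A * t + A := hA1.trans (Nat.le_add_left A (A * t))
  have hBA : 1 ≤ B ^ (A * t + A) := Nat.one_le_pow _ _ (by omega)
  have hone : ∀ q : MvPolynomial (σ n) K, q.totalDegree ≤ t →
      HasSPSPExpr q (B ^ (A * t + A)) (A * t + A) t := by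
    intro q hq
    have h0 : HasSPSPExpr q 1 1 t :=
      ⟨fun _ _ => q, fun _ _ => hq, by simp only [Fin.sum_univ_one, Fin.prod_univ_one]⟩
    exact hasSPSPExpr_mono h0 hBA hAt hAt le_rfl
  by_cases hd0 : d = 0
  · exact hone g (by omega)
  have ht1 : 1 ≤ t := by rw [htd, Nat.le_sqrt]; omega
  obtain ⟨P, hfan, hcomp, hsize⟩ := ArithCircuit.exists_computes_size_eq_complexity g
  obtain ⟨S, hlen, hcases⟩ := DepthReduction.exists_slp P hfan
  rw [show P.eval = g from hcomp] at hcases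
  rcases hcases with ⟨i, hi, hgi⟩ | ⟨j, hgj⟩ | ⟨c, hgc⟩
  · have hdi : (S.val i).IsHomogeneous d := by rw [← hgi]; exact hgh
    obtain ⟨L, hsum, hLlen, hT⟩ :=
      S.exists_sum_prod_component_hom d ht1 ⟨i, hi⟩ ⟨d, Nat.lt_succ_self d⟩
    have hsum' : (L.map List.prod).sum = g := by
      rw [hsum, hgi]
      exact homogeneousComponent_eq_self hdi
    set W := 1 + 4 * (8 * d / (t + 1)) with hW
    have hexpr : HasSPSPExpr g L.length W t := by
      refine ⟨fun τ π => (L[τ.val]).getD π.val 1, fun τ π => ?_, ?_⟩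
      · show ((L[τ.val]).getD π.val 1).totalDegree ≤ t
        rcases DepthReduction.getD_one_mem_or (L[τ.val]) π.val with h | h
        · obtain ⟨e', he', hhe'⟩ := (hT _ (List.getElem_mem _)).2 _ h
          exact hhe'.totalDegree_le.trans he'
        · rw [h, totalDegree_one]
          exact Nat.zero_le _
      · have hpτ : ∀ τ : Fin L.length,
            ∏ π : Fin W, (L[τ.val]).getD π.val 1 = (L[τ.val]).prod :=
          fun τ => DepthReduction.prod_getD_one _ W (hT _ (List.getElem_mem _)).1
        rw [← hsum']
        simp only [hpτ]
        exact (Fin.sum_univ_fun_getElem L List.prod).symm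
    have h4 := DepthReduction.four_mul_pow_le B a hB2
    have hdd : d ≤ 2 * B ^ a := DepthReduction.le_two_mul_pow (h2 n) (by omega)
    have hss : S.len ≤ 2 * B ^ a := by
      rw [hlen, hsize]; exact DepthReduction.le_two_mul_pow (h3 n) (by omega)
    have hd1 : d + 1 ≤ B ^ E := by rw [hE]; omega
    have hsE : S.len ≤ B ^ E := by rw [hE]; omega
    have hdt : d < (t + 1) * (t + 1) := Nat.lt_succ_sqrt d
    have hR : 8 * d / (t + 1) ≤ 8 * (t + 1) := Nat.div_le_of_le_mul (by nlinarith [hdt.le])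
    have hS1 : 4 * S.len * (d + 1) ^ 2 ≤ B ^ (3 * E + 2) :=
      calc 4 * S.len * (d + 1) ^ 2 ≤ 4 * B ^ E * (B ^ E) ^ 2 :=
            Nat.mul_le_mul (Nat.mul_le_mul_left 4 hsE) (Nat.pow_le_pow_left hd1 2)
        _ = 4 * B ^ (3 * E) := by ring
        _ ≤ B ^ (3 * E + 2) := DepthReduction.four_mul_pow_le B _ hB2
    have hS2 : (4 * S.len * (d + 1) ^ 2) * (4 * S.len * (d + 1) ^ 2) ≤ B ^ (6 * E + 4) :=
      calc _ ≤ B ^ (3 * E + 2) * B ^ (3 * E + 2) := Nat.mul_le_mul hS1 hS1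
        _ = B ^ (6 * E + 4) := by
          rw [← pow_add, show 3 * E + 2 + (3 * E + 2) = 6 * E + 4 by omega]
    have hexp : (6 * E + 4) * (8 * (t + 1)) = A * t + A := by rw [hA]; ring
    have hLB : L.length ≤ B ^ (A * t + A) :=
      calc L.length
          ≤ ((4 * S.len * (d + 1) ^ 2) * (4 * S.len * (d + 1) ^ 2)) ^ (8 * d / (t + 1)) := hLlen
        _ ≤ (B ^ (6 * E + 4)) ^ (8 * d / (t + 1)) := Nat.pow_le_pow_left hS2 _
        _ ≤ (B ^ (6 * E + 4)) ^ (8 * (t + 1)) :=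
          Nat.pow_le_pow_right (Nat.pow_pos (by omega)) hR
        _ = B ^ (A * t + A) := by rw [← pow_mul, hexp]
    have hWA : W ≤ A * t + A := by
      have h32 : 32 * t ≤ A * t := Nat.mul_le_mul_right t (by omega)
      rw [hW]; omega
    exact hasSPSPExpr_mono hexpr hLB hWA hAt le_rfl
  · rw [hgj]
    exact hone (X j) ((isHomogeneous_X K j).totalDegree_le.trans ht1)
  · rw [hgc]
    exact hone (C c) (by rw [totalDegree_C]; exact Nat.zero_le _)

/-- The permanent instance of `hasSPSPExpr_of_isVPFamily` (`deg per_n = n`, `per_n` homogeneous):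
IF `per ∈ VP` then `per_n` has `ΣΠ^{[a⌊√n⌋+a]}ΣΠ^{[⌊√n⌋]}` expressions with at most
`(n+2)^(a⌊√n⌋+a)` summands.  [cite: Tavenas2015, Thm. 1; Landsberg2017, Thm. 7.5.2.1] -/
theorem hasSPSPExpr_perPoly_of_isVPFamily (K : Type*) [CommSemiring K] [Nontrivial K]
    (hper : IsVPFamily (fun n => perPoly (Fin n) K)) :
    ∃ a : ℕ, ∀ n : ℕ, HasSPSPExpr (perPoly (Fin n) K) ((n + 2) ^ (a * Nat.sqrt n + a))
      (a * Nat.sqrt n + a) (Nat.sqrt n) := by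
  have hdeg : ∀ n : ℕ, (perPoly (Fin n) K).totalDegree = n := by
    intro n
    rw [totalDegree_perPoly_holds (n := Fin n) (k := K), Fintype.card_fin]
  have hhom : ∀ n : ℕ, (perPoly (Fin n) K).IsHomogeneous (perPoly (Fin n) K).totalDegree := by
    intro n
    rw [hdeg n]
    simpa only [Fintype.card_fin] using (perPoly_isHomogeneous (n := Fin n) (k := K))
  obtain ⟨a, ha⟩ := hasSPSPExpr_of_isVPFamily (fun n => perPoly (Fin n) K) hper hhom
  refine ⟨a, fun n => ?_⟩
  have h : HasSPSPExpr (perPoly (Fin n) K)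
      ((n + 2) ^ (a * Nat.sqrt (perPoly (Fin n) K).totalDegree + a))
      (a * Nat.sqrt (perPoly (Fin n) K).totalDegree + a)
      (Nat.sqrt (perPoly (Fin n) K).totalDegree) := ha n
  rw [hdeg n] at h
  exact h

/-- **The bounded door yields the summit.**  WEAKEST SUFFICIENT CELL on the chasm axis in ONE
currency (HasSPSPExpr, bottom fan-in ⌊√n⌋): BoundedDoor ⟹ VP ≠ VNP (Tavenas 2015 Thm 1 WITH
fan-ins) and 11333 ⟹ BoundedDoor (converse NOT claimed; strictness UNDECIDED); KNOWN in print
(Landsberg 2017 §7.5–7.6); NOT a rung; 0 S-currency (VP ≠ VNP does not imply BoundedDoor);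
VP ≠ VNP untouched.  SEAM: the floor 2^{ε√n} in this currency (gkks_depth4_holds) holds for
det_n as well, and det_n ∈ VP has door-sized expressions (Tavenas with fan-ins) — the residual
Θ_c(log n) factor in the exponent is PER-SPECIFIC; any proof of BoundedDoor exhibits, at some n,
a property of per_n that det_n provably lacks. [cite: Tavenas2015, Thm. 1; Landsberg2017,
Thm. 7.5.2.1 and §7.6; GuptaKamathKayalSaptharishi2014, Thm. 1] -/
theorem valiantsHypothesis_of_boundedDoor
    (h : ∀ c : ℕ, ∃ n : ℕ, ¬ HasSPSPExpr (perPoly (Fin n) ℂ) ((n + 2) ^ (c * Nat.sqrt n + c))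
      (c * Nat.sqrt n + c) (Nat.sqrt n)) :
    _root_.ValiantsHypothesis := by
  show Literature.Computability.AlgebraicComplexity.VP ℂ ≠
    Literature.Computability.AlgebraicComplexity.VNP ℂ
  intro hEq
  have hVNP := perFamily_mem_VNP_holds ℂ
  have hVP : perFamily ℂ ∈ VP ℂ := by rw [hEq]; exact hVNP
  have hfam : IsVPFamily (fun n => perPoly (Fin n) ℂ) := (mem_VP_ofFintype_iff_holds _).1 hVP
  obtain ⟨a, ha⟩ := hasSPSPExpr_perPoly_of_isVPFamily ℂ hfam
  obtain ⟨n, hn⟩ := h a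
  exact hn (ha n)

/-- A polynomial of total degree `≤ t` is the sum of its homogeneous components `0, …, t`. -/
private theorem sum_fin_homogeneousComponent {K : Type*} [CommSemiring K] {σ : Type*}
    (q : MvPolynomial σ K) {t : ℕ} (hq : q.totalDegree ≤ t) :
    ∑ r : Fin (t + 1), homogeneousComponent (r : ℕ) q = q := by
  have hz : ∑ r ∈ Finset.range (q.totalDegree + 1), homogeneousComponent r q =
      ∑ r ∈ Finset.range (t + 1), homogeneousComponent r q :=
    Finset.sum_subset (Finset.range_subset_range.2 (Nat.add_le_add_right hq 1))
      fun r _ hr => homogeneousComponent_eq_zero _ _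
        (by rw [Finset.mem_range, not_lt] at hr; omega)
  rw [Fin.sum_univ_eq_sum_range (fun r => homogeneousComponent r q) (t + 1), ← hz]
  exact sum_homogeneousComponent q

/-- Reindexing: expand `∑ᵢ ∏ⱼ Qᵢⱼ` after splitting every factor into `t + 1` homogeneous pieces. -/
private theorem sum_prod_reindex {K : Type*} [CommSemiring K] {σ : Type*} {s D t T : ℕ}
    (Q : Fin s → Fin D → MvPolynomial σ K) (hQ : ∀ i j, (Q i j).totalDegree ≤ t)
    (e : Fin s × (Fin D → Fin (t + 1)) ≃ Fin T) (p : Fin T → Fin D → MvPolynomial σ K)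
    (hp : ∀ τ j, p τ j =
      homogeneousComponent (((e.symm τ).2 j : Fin (t + 1)) : ℕ) (Q (e.symm τ).1 j)) :
    ∑ τ, ∏ j, p τ j = ∑ i, ∏ j, Q i j :=
  calc ∑ τ, ∏ j, p τ j
      = ∑ τ, ∏ j, homogeneousComponent (((e.symm τ).2 j : Fin (t + 1)) : ℕ) (Q (e.symm τ).1 j) :=
        Fintype.sum_congr _ _ fun τ => Fintype.prod_congr _ _ fun j => hp τ j
    _ = ∑ x : Fin s × (Fin D → Fin (t + 1)),
          ∏ j, homogeneousComponent ((x.2 j : Fin (t + 1)) : ℕ) (Q x.1 j) :=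
        e.symm.sum_comp fun x => ∏ j, homogeneousComponent ((x.2 j : Fin (t + 1)) : ℕ) (Q x.1 j)
    _ = ∑ i, ∑ v : Fin D → Fin (t + 1),
          ∏ j, homogeneousComponent ((v j : Fin (t + 1)) : ℕ) (Q i j) :=
        Fintype.sum_prod_type' fun i (v : Fin D → Fin (t + 1)) =>
          ∏ j, homogeneousComponent ((v j : Fin (t + 1)) : ℕ) (Q i j)
    _ = ∑ i, ∏ j, ∑ r : Fin (t + 1), homogeneousComponent (r : ℕ) (Q i j) :=
        Fintype.sum_congr _ _ fun i =>
          (Fintype.prod_sum fun j (r : Fin (t + 1)) => homogeneousComponent (r : ℕ) (Q i j)).symm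
    _ = ∑ i, ∏ j, Q i j :=
        Fintype.sum_congr _ _ fun i => Fintype.prod_congr _ _ fun j =>
          sum_fin_homogeneousComponent (Q i j) (hQ i j)

/-- A `ΣΠ^{[D]}ΣΠ^{[t]}` expression (`t ≥ 1`) of a homogeneous polynomial is computed by a
homogeneous `ΣΠΣΠ` circuit with at most `(t+1)(N+t)^t + s(t+1)^D·D + s(t+1)^D + 1` gates (expand
by `sum_prod_reindex`; realise the pieces on the monomials of degree `≤ t`). [cite: Tavenas2015] -/
theorem homDepthFourCircuitSize_le_of_hasSPSPExpr {K : Type*} [CommSemiring K] {σ : Type*}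
    [Fintype σ] [DecidableEq σ] {f : MvPolynomial σ K} {d s D t : ℕ} (hf : f.IsHomogeneous d)
    (ht : 1 ≤ t) (h : HasSPSPExpr f s D t) :
    homDepthFourCircuitSize f ≤
      (((t + 1) * (Fintype.card σ + t) ^ t + s * (t + 1) ^ D * D + s * (t + 1) ^ D + 1 : ℕ) :
        ℕ∞) := by
  classical
  obtain ⟨Q, hQ, hfQ⟩ := h
  obtain ⟨e⟩ : Nonempty (Fin s × (Fin D → Fin (t + 1)) ≃ Fin (s * (t + 1) ^ D)) :=
    ⟨Fintype.equivFinOfCardEq (by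
      rw [Fintype.card_prod, Fintype.card_fun, Fintype.card_fin, Fintype.card_fin,
        Fintype.card_fin])⟩
  obtain ⟨p, hp_def⟩ : ∃ p : Fin (s * (t + 1) ^ D) → Fin D → MvPolynomial σ K, ∀ τ j,
      p τ j = homogeneousComponent (((e.symm τ).2 j : Fin (t + 1)) : ℕ) (Q (e.symm τ).1 j) :=
    ⟨_, fun _ _ => rfl⟩
  have htot : ∑ τ, ∏ j, p τ j = f := (sum_prod_reindex Q hQ e p hp_def).trans hfQ.symm
  let U : Finset (σ →₀ ℕ) := (Finset.univ : Finset (Fin (s * (t + 1) ^ D) × Fin D)).biUnion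
    fun x => (p x.1 x.2).support
  have hp : ∀ τ π, (p τ π).support ⊆ U := fun τ π =>
    Finset.subset_biUnion_of_mem (fun x : Fin (s * (t + 1) ^ D) × Fin D => (p x.1 x.2).support)
      (Finset.mem_univ (τ, π))
  have hdegp : ∀ τ π, (p τ π).totalDegree ≤ t := fun τ π => by
    rw [hp_def]
    exact (homogeneousComponent_isHomogeneous _ _).totalDegree_le.trans
      (Nat.le_of_lt_add_one ((e.symm τ).2 π).isLt)
  have hhom : ∀ τ π, ∃ k, (p τ π).IsHomogeneous k := fun τ π =>
    ⟨((e.symm τ).2 π : ℕ), by rw [hp_def]; exact homogeneousComponent_isHomogeneous _ _⟩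
  have hsum : ∃ k, (∑ τ, ∏ π, p τ π).IsHomogeneous k := ⟨d, by rw [htot]; exact hf⟩
  obtain ⟨C, hCe, hC4, hCh, hCs⟩ :=
    DepthReduction.exists_depthFour_circuit_sum_prod (s * (t + 1) ^ D) D p U hp hhom hsum
  have hU : U.card ≤ (t + 1) * (Fintype.card σ + t) ^ t := by
    apply DepthReduction.card_le_of_degree_le U ht
    intro m hm
    simp only [U, Finset.mem_biUnion, Finset.mem_univ, true_and] at hm
    obtain ⟨⟨τ, π⟩, hm⟩ := hm
    exact (le_totalDegree hm).trans (hdegp τ π)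
  refine (homDepthFourCircuitSize_le (hCe.trans htot) hC4 hCh).trans ?_
  rw [hCs]
  exact_mod_cast Nat.add_le_add_right (Nat.add_le_add_right (Nat.add_le_add_right hU _) _) _

/-- **The certified one-way arrow `Depth4HomFour ⟹ BoundedDoor`** (any commutative semiring; at
`K = ℂ` the hypothesis is `Theses.Depth4.Depth4HomFour`, stmt 11333, verbatim).  WEAKEST
SUFFICIENT CELL on the chasm axis in ONE currency (HasSPSPExpr, bottom fan-in ⌊√n⌋):
BoundedDoor ⟹ VP ≠ VNP (Tavenas 2015 Thm 1 WITH fan-ins) and 11333 ⟹ BoundedDoor (converse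
NOT claimed; strictness UNDECIDED); KNOWN in print (Landsberg 2017 §7.5–7.6); NOT a rung;
0 S-currency (VP ≠ VNP does not imply BoundedDoor); VP ≠ VNP untouched.  SEAM: the floor 2^{ε√n}
in this currency (gkks_depth4_holds) holds for det_n as well, and det_n ∈ VP has door-sized
expressions (Tavenas with fan-ins) — the residual Θ_c(log n) factor in the exponent is
PER-SPECIFIC; any proof of BoundedDoor exhibits, at some n, a property of per_n that det_n
provably lacks. [cite: Tavenas2015, §6 (padding: `c ↦ 3c+4`)] -/
theorem boundedDoor_of_depth4HomFour (K : Type*) [CommSemiring K]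
    (h : ∀ c : ℕ, ∃ n : ℕ,
      ((n + 2 : ℕ∞) ^ (c * Nat.sqrt n + c)) < homDepthFourCircuitSize (perPoly (Fin n) K)) :
    ∀ c : ℕ, ∃ n : ℕ, ¬ HasSPSPExpr (perPoly (Fin n) K) ((n + 2) ^ (c * Nat.sqrt n + c))
      (c * Nat.sqrt n + c) (Nat.sqrt n) := by
  classical
  intro c
  by_contra hcon
  push Not at hcon
  obtain ⟨n, hn⟩ := h (3 * c + 4)
  refine absurd hn (not_lt.2 ?_)
  have hhomn : (perPoly (Fin n) K).IsHomogeneous n := by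
    simpa only [Fintype.card_fin] using (perPoly_isHomogeneous (n := Fin n) (k := K))
  rcases Nat.eq_zero_or_pos n with rfl | hnpos
  · have hd0 : (perPoly (Fin 0) K).totalDegree = 0 := Nat.le_zero.1 hhomn.totalDegree_le
    have hC : (ArithCircuit.ofConst ((perPoly (Fin 0) K).coeff 0) :
        ArithCircuit K (Fin 0 × Fin 0)).Computes (perPoly (Fin 0) K) := by
      show ArithCircuit.eval _ = _
      rw [ArithCircuit.eval_ofConst]
      exact (totalDegree_eq_zero_iff_eq_C.1 hd0).symm
    refine (homDepthFourCircuitSize_le hC (ArithCircuit.isDepthFour_ofConst _)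
      (ArithCircuit.isHomogeneousCircuit_ofConst _)).trans ?_
    rw [ArithCircuit.size_ofConst, Nat.cast_zero]
    exact zero_le
  have ht1 : 1 ≤ Nat.sqrt n := Nat.le_sqrt.2 (by omega)
  have hsize := homDepthFourCircuitSize_le_of_hasSPSPExpr hhomn ht1 (hcon n)
  have hcard : Fintype.card (Fin n × Fin n) = n * n := by
    rw [Fintype.card_prod, Fintype.card_fin]
  rw [hcard] at hsize
  refine hsize.trans ?_
  set t := Nat.sqrt n
  have htn : t ≤ n := Nat.sqrt_le_self n
  have hB1 : 0 < n + 2 := by omega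
  have h1 : t + 1 ≤ n + 2 := by omega
  have h2 : n * n + t ≤ (n + 2) ^ 2 := by nlinarith [htn]
  have hterm1 : (t + 1) * (n * n + t) ^ t ≤ (n + 2) ^ (2 * t + 1) :=
    calc (t + 1) * (n * n + t) ^ t ≤ (n + 2) * ((n + 2) ^ 2) ^ t :=
          Nat.mul_le_mul h1 (Nat.pow_le_pow_left h2 t)
      _ = (n + 2) ^ (2 * t + 1) := by rw [← pow_mul, ← pow_succ']
  have hpowD : (t + 1) ^ (c * t + c) ≤ (n + 2) ^ (c * t + c) := Nat.pow_le_pow_left h1 _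
  have hDle : c * t + c ≤ (n + 2) ^ (c * t + c) :=
    (Nat.lt_two_pow_self).le.trans (Nat.pow_le_pow_left (by omega) _)
  have hterm2 : (n + 2) ^ (c * t + c) * (t + 1) ^ (c * t + c) * (c * t + c) ≤
      (n + 2) ^ (3 * (c * t + c)) :=
    calc _ ≤ (n + 2) ^ (c * t + c) * (n + 2) ^ (c * t + c) * (n + 2) ^ (c * t + c) :=
          Nat.mul_le_mul (Nat.mul_le_mul le_rfl hpowD) hDle
      _ = (n + 2) ^ (3 * (c * t + c)) := by
          rw [← pow_add, ← pow_add,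
            show c * t + c + (c * t + c) + (c * t + c) = 3 * (c * t + c) by omega]
  have hterm3 : (n + 2) ^ (c * t + c) * (t + 1) ^ (c * t + c) ≤ (n + 2) ^ (2 * (c * t + c)) :=
    calc _ ≤ (n + 2) ^ (c * t + c) * (n + 2) ^ (c * t + c) := Nat.mul_le_mul le_rfl hpowD
      _ = (n + 2) ^ (2 * (c * t + c)) := by
          rw [← pow_add, show c * t + c + (c * t + c) = 2 * (c * t + c) by omega]
  set M := 3 * (c * t + c) + 2 * t + 1 with hM
  have hfin : (3 * c + 4) * t + (3 * c + 4) = M + 2 + (2 * t + 1) := by rw [hM]; ring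
  have key : (t + 1) * (n * n + t) ^ t
      + (n + 2) ^ (c * t + c) * (t + 1) ^ (c * t + c) * (c * t + c)
      + (n + 2) ^ (c * t + c) * (t + 1) ^ (c * t + c) + 1 ≤
      (n + 2) ^ ((3 * c + 4) * t + (3 * c + 4)) :=
    calc _ ≤ (n + 2) ^ M + (n + 2) ^ M + (n + 2) ^ M + (n + 2) ^ M :=
          Nat.add_le_add (Nat.add_le_add (Nat.add_le_add
            (hterm1.trans (Nat.pow_le_pow_right hB1 (by omega)))
            (hterm2.trans (Nat.pow_le_pow_right hB1 (by omega))))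
            (hterm3.trans (Nat.pow_le_pow_right hB1 (by omega)))) (Nat.one_le_pow _ _ hB1)
      _ = 4 * (n + 2) ^ M := by omega
      _ ≤ (n + 2) ^ (M + 2) := DepthReduction.four_mul_pow_le (n + 2) M (by omega)
      _ ≤ (n + 2) ^ ((3 * c + 4) * t + (3 * c + 4)) :=
          Nat.pow_le_pow_right hB1 (by rw [hfin]; omega)
  exact_mod_cast key

end Summit.ValiantsHypothesis.ValiantsHypothesis.Theorems.Depth4BoundedDoor
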